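import Summits.Ventures.HSemireg.UntwistCocycleTwistDualHom
import Literature.AlgebraicGeometry.HodgeTheory.AtiyahClass
import HarnessLib

/-!
# Venture HSemireg — route R1.0, untwisted reading: the jet module of `E ⊗ M` in the local trivialisations,
# `J_x : P¹(E)| → P¹(E⟨c⟩)|` (gs-g4; sequel of `UntwistCocycleTwistDualHom.lean`)

HONEST FRAMING. Module-level sheaf algebra on the tree's REAL carriers: Atiyah's jet module
`P¹(E) = jetModule E` and its sequence `0 → E ⊗ Ω¹ → P¹(E) → E → 0` (`HodgeTheory/AtiyahClass.lean`), th-4's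
cocycle twist `E⟨c⟩ = E ⊗ M` (files #11–#14) and the comparison `λ = CocycleTwist.dualHomTwist`. Nothing about
any variety; no gerbe; nothing here says HC, HC_CM or HC_AV is proved.

WHAT IS PROVED (the local computation behind the Leibniz rule `At(E ⊗ M) = At(E) ⊗ 1 + 1 ⊗ At(M)` for a line
bundle `M = lineBundle c`, Atiyah 1957 Prop. 10/12, at the level of SECTIONS; the `Ext`-classes are in the sequel):

* `jetTwistOver c E x W` (`J_x`) — **`P¹(E)|_W ⟶ P¹(E⟨c⟩)|_W` over `W ⊆ U_x`, `(e, η) ↦ (e ⊗ t_x, λ(η ⊗ t_x))`**,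
  a morphism of `𝒪_X`-modules for the TWISTED structures `a · (e, η) = (a e, a η + e ⊗ da)` on both sides —
  `𝒪`-linear exactly because `λ((e ⊗ da) ⊗ t_x) = (e ⊗ t_x) ⊗ da` (`dualHomTwist_trivSection_evalAt_smulSection`);
  it covers `t_x : E| ≅ E⟨c⟩|` on the quotients and `t_x ≫ λ` on the kernels (`jetTwistOver_fst`, `_snd`);
* the `Hom`-typed restatements of th-4's section calculus (`trivSection_add_hom`, …) and the sections
  `e ⊗ ω = tensorForm` of `F ⊗ G = 𝓗om(F^∨, G)` used for it; the transported sections and the Leibniz cocycle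
  identity are the sequel `UntwistCocycleTwistLeibnizCocycle.lean`.

Which Ext groups: none yet (sections only; the classes `At(E⟨c⟩)`, `θ(At(E))` are compared in the sequel); which
twist: `- ⊗ M_B`, `M_B = lineBundle c`.

## References

* M. F. Atiyah, *Complex analytic connections in fibre bundles*, Trans. AMS 85 (1957), §4 (`D(E)`, `b(E)`),
  Prop. 10 and Prop. 12 (`b(L)` of a line bundle is `{d log g_{ij}}`). [Atiyah1957]
* R.-O. Buchweitz, H. Flenner, Compositio Math. 137 (2003), §3 (Atiyah class). [BuchweitzFlenner2003]
* R. Hartshorne, *Algebraic Geometry* (1977), II Ex. 5.1 (b), III Ex. 4.5. [Hartshorne1977]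
-/

noncomputable section

open CategoryTheory AlgebraicGeometry Opposite TopologicalSpace

namespace Summit.Ventures.HSemireg

namespace CocycleTwist

open Literature.AlgebraicGeometry.Modules Literature.AlgebraicGeometry.Motives
  Literature.AlgebraicGeometry.HodgeTheory

universe u

variable {S : Type u} [CommRing S] {X : Over (Spec (CommRingCat.of S))} (c : UnitCocycle X.left)
  (E : X.left.Modules)

/-! ### Twisted sections along module maps; the `x`-coordinate at two points -/

/-- `f⟨c⟩(m ⊗ t_z) = f(m) ⊗ t_z` for a morphism of modules `f`. [folklore] -/
theorem twistMap_app_trivSection {F G : X.left.Modules} (f : F ⟶ G) (z : X.left) {V : X.left.Opens}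
    (hV : V ≤ c.U z) (m : Γ(F, V)) :
    (twistMap c f).app V (trivSection c F z hV m) = trivSection c G z hV (f.app V m) :=
  twist_ext c G fun w => by
    rw [comp_twistMap_app, comp_trivSection, comp_trivSection, Scheme.Modules.Hom.app_smul, app_map_apply]

/-- `e ⊗ t_z` is compatible with subtraction. [folklore] -/
theorem trivSection_sub (F : X.left.Modules) (z : X.left) {V : X.left.Opens} (hV : V ≤ c.U z) (m m' : Γ(F, V)) :
    trivSection c F z hV (m - m') = trivSection c F z hV m - trivSection c F z hV m' :=
  map_sub (⟨⟨trivSection c F z hV, trivSection_zero c F z hV⟩, trivSection_add c F z hV⟩ :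
    Γ(F, V) →+ Γ(twist c F, V)) m m'

/-! ### The same calculus for twisted sections of an internal Hom, in the `Hom`-typed spelling

Sections of `𝓗om(A, B)` over `V` are literally morphisms `A|_V ⟶ B|_V`; the algebraic operations on them are
definitionally, but not syntactically, those of `Γ(𝓗om(A, B), V)`. The following restatements let `rw` see them. -/

section HomSpelling

variable {A B : X.left.Modules} (z : X.left) {V : X.left.Opens} (hV : V ≤ c.U z)

/-- `(φ + ψ) ⊗ t_z = φ ⊗ t_z + ψ ⊗ t_z` (Hom-typed spelling). [folklore] -/
theorem trivSection_add_hom (φ ψ : A.over V ⟶ B.over V) :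
    trivSection c (sheafHom A B) z hV (φ + ψ) = trivSection c (sheafHom A B) z hV φ + trivSection c (sheafHom A B) z hV ψ :=
  trivSection_add c (sheafHom A B) z hV φ ψ

/-- `(φ - ψ) ⊗ t_z = φ ⊗ t_z - ψ ⊗ t_z` (Hom-typed spelling). [folklore] -/
theorem trivSection_sub_hom (φ ψ : A.over V ⟶ B.over V) :
    trivSection c (sheafHom A B) z hV (φ - ψ) = trivSection c (sheafHom A B) z hV φ - trivSection c (sheafHom A B) z hV ψ :=
  trivSection_sub c (sheafHom A B) z hV φ ψ

/-- `(a φ) ⊗ t_z = a (φ ⊗ t_z)` (Hom-typed spelling). [folklore] -/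
theorem trivSection_smul_hom (a : Γ(X.left, V)) (φ : A.over V ⟶ B.over V) :
    trivSection c (sheafHom A B) z hV (a • φ) = a • trivSection c (sheafHom A B) z hV φ :=
  trivSection_smul c (sheafHom A B) z hV a φ

/-- `φ ⊗ t_x = (g_{yx} φ) ⊗ t_y` (Hom-typed spelling). [folklore] -/
theorem trivSection_eq_trivSection_smul_hom (x y : X.left) (hx : V ≤ c.U x) (hy : V ≤ c.U y)
    (φ : A.over V ⟶ B.over V) :
    trivSection c (sheafHom A B) x hx φ = trivSection c (sheafHom A B) y hy (c.g y x V hy hx • φ) :=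
  trivSection_eq_trivSection_smul c (sheafHom A B) x y hx hy φ

/-- `(a • p).fst = a • p.fst` for the module structure on `Γ(P¹(F), V)` (sections spelling). [folklore] -/
theorem fst_smul_sections {F : X.left.Modules} (a : Γ(X.left, V)) (p : Γ(jetModule F, V)) :
    JetSections.fst ((a • p : Γ(jetModule F, V)) : JetSections F V) = a • JetSections.fst (p : JetSections F V) := rfl

/-- `(a • p).snd = a • p.snd + δ(a, p.fst)` for the module structure on `Γ(P¹(F), V)` (sections spelling).
[cite: Atiyah1957, §4] -/
theorem snd_smul_sections {F : X.left.Modules} (a : Γ(X.left, V)) (p : Γ(jetModule F, V)) :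
    JetSections.snd ((a • p : Γ(jetModule F, V)) : JetSections F V) =
      a • JetSections.snd (p : JetSections F V) + deltaHom F V a (JetSections.fst (p : JetSections F V)) := rfl

/-- `(p - q).snd = p.snd - q.snd` on `Γ(P¹(F), V)` (sections spelling). [folklore] -/
theorem snd_sub_sections {F : X.left.Modules} (p q : Γ(jetModule F, V)) :
    JetSections.snd ((p - q : Γ(jetModule F, V)) : JetSections F V) =
      JetSections.snd (p : JetSections F V) - JetSections.snd (q : JetSections F V) := rfl

end HomSpelling

/-! ### The sections `e ⊗ ω` of `F ⊗ G = 𝓗om(F^∨, G)` -/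

section TensorForm

variable (F G : X.left.Modules) {V : X.left.Opens}

/-- **`e ⊗ ω ∈ Γ(F ⊗ G, V)`** on the model `F ⊗ G = 𝓗om(F^∨, G)`: the homomorphism `μ ↦ μ(e) · ω`
(`evalAt e ≫ smulSection ω`; Atiyah's twisting term is `δ(a, e) = e ⊗ da`). [cite: Hartshorne1977, II Ex. 5.1 (b)] -/
def tensorForm (e : Γ(F, V)) (ω : Γ(G, V)) : Γ(sheafHom (dual F) G, V) :=
  (evalAt (M := unitModule X.left) e ≫ smulSection ω : (dual F).over V ⟶ G.over V)

/-- Unfolding `e ⊗ ω`. [folklore] -/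
theorem tensorForm_def (e : Γ(F, V)) (ω : Γ(G, V)) :
    tensorForm F G e ω = (evalAt (M := unitModule X.left) e ≫ smulSection ω : (dual F).over V ⟶ G.over V) := rfl

/-- Atiyah's twisting term is `δ(a, e) = e ⊗ da`. [cite: Atiyah1957, §4] -/
theorem deltaHom_eq_tensorForm (a : Γ(X.left, V)) (e : Γ(F, V)) :
    (deltaHom F V a e : Γ(twistCotangent F, V)) = tensorForm F (cotangentSheaf X) e (dSection X V a) := rfl

/-- `(a e) ⊗ ω = a (e ⊗ ω)`. [folklore] -/
theorem tensorForm_smul_left (a : Γ(X.left, V)) (e : Γ(F, V)) (ω : Γ(G, V)) :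
    tensorForm F G (a • e) ω = a • tensorForm F G e ω := by
  change (evalAt (M := unitModule X.left) (a • e) ≫ smulSection ω : (dual F).over V ⟶ G.over V) =
    a • (evalAt (M := unitModule X.left) e ≫ smulSection ω)
  rw [evalAt_smul, smul_comp_overHom]

/-- `e ⊗ (a ω) = a (e ⊗ ω)`. [folklore] -/
theorem tensorForm_smul_right (a : Γ(X.left, V)) (e : Γ(F, V)) (ω : Γ(G, V)) :
    tensorForm F G e (a • ω) = a • tensorForm F G e ω := by
  change (evalAt (M := unitModule X.left) e ≫ smulSection (a • ω) : (dual F).over V ⟶ G.over V) =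
    a • (evalAt (M := unitModule X.left) e ≫ smulSection ω)
  rw [smulSection_smul, comp_smul_overHom]

/-- `e ⊗ (-ω) = -(e ⊗ ω)`. [folklore] -/
theorem tensorForm_neg_right (e : Γ(F, V)) (ω : Γ(G, V)) :
    tensorForm F G e (-ω) = -tensorForm F G e ω := by
  have h : tensorForm F G e (-ω) + tensorForm F G e ω = 0 := by
    change (evalAt (M := unitModule X.left) e ≫ smulSection (-ω) + evalAt (M := unitModule X.left) e ≫ smulSection ω :
      (dual F).over V ⟶ G.over V) = 0
    rw [← Preadditive.comp_add, ← smulSection_add, neg_add_cancel, smulSection_zero, Limits.comp_zero]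
  exact eq_neg_of_add_eq_zero_left h

variable {F G} in
/-- **`λ_G((e ⊗ ω) ⊗ t_z) = (e ⊗ t_z) ⊗ ω`** (`dualHomTwist_trivSection_evalAt_smulSection` in the `⊗` notation).
[folklore] -/
theorem dualHomTwist_app_trivSection_tensorForm (z : X.left) (hV : V ≤ c.U z) (e : Γ(F, V)) (ω : Γ(G, V)) :
    (dualHomTwist c F G).app V (trivSection c (sheafHom (dual F) G) z hV (tensorForm F G e ω)) =
      tensorForm (twist c F) G (trivSection c F z hV e) ω :=
  dualHomTwist_trivSection_evalAt_smulSection c F G z hV e ω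

end TensorForm

/-! ### `J_x : P¹(E)|_W ⟶ P¹(E⟨c⟩)|_W` -/

section Jet

variable (x : X.left) (W : X.left.Opens) (hW : W ≤ c.U x)

/-- The map on jet sections over `V ⊆ W ⊆ U_x`: `(e, η) ↦ (e ⊗ t_x, λ(η ⊗ t_x))`. [folklore] -/
def jetTwistFun {V : X.left.Opens} (hV : V ≤ c.U x) (p : JetSections E V) : JetSections (twist c E) V :=
  JetSections.mk (trivSection c E x hV p.fst)
    ((dualHomTwist c E (cotangentSheaf X)).app V (trivSection c (twistCotangent E) x hV p.snd) :
      (dual (twist c E)).over V ⟶ (cotangentSheaf X).over V)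

/-- First component of `J_x(p)`: `p.fst ⊗ t_x`. [folklore] -/
@[simp]
theorem jetTwistFun_fst {V : X.left.Opens} (hV : V ≤ c.U x) (p : JetSections E V) :
    (jetTwistFun c E x hV p).fst = trivSection c E x hV p.fst := rfl

/-- Second component of `J_x(p)`: `λ(p.snd ⊗ t_x)`. [folklore] -/
@[simp]
theorem jetTwistFun_snd {V : X.left.Opens} (hV : V ≤ c.U x) (p : JetSections E V) :
    (jetTwistFun c E x hV p).snd =
      ((dualHomTwist c E (cotangentSheaf X)).app V (trivSection c (twistCotangent E) x hV p.snd) :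
        (dual (twist c E)).over V ⟶ (cotangentSheaf X).over V) := rfl

/-- `J_x` is additive. [folklore] -/
theorem jetTwistFun_add {V : X.left.Opens} (hV : V ≤ c.U x) (p q : JetSections E V) :
    jetTwistFun c E x hV (p + q) = jetTwistFun c E x hV p + jetTwistFun c E x hV q := by
  refine JetSections.ext ?_ ?_
  · simp only [jetTwistFun_fst, JetSections.fst_add, trivSection_add]
  · rw [jetTwistFun_snd, JetSections.snd_add, JetSections.snd_add, jetTwistFun_snd, jetTwistFun_snd,
      trivSection_add_hom, map_add]
    rfl

/-- `J_x(0) = 0`. [folklore] -/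
theorem jetTwistFun_zero {V : X.left.Opens} (hV : V ≤ c.U x) : jetTwistFun c E x hV (0 : JetSections E V) = 0 := by
  refine JetSections.ext ?_ ?_
  · simp only [jetTwistFun_fst, JetSections.fst_zero, trivSection_zero]
  · rw [jetTwistFun_snd, JetSections.snd_zero, JetSections.snd_zero]
    change (dualHomTwist c E (cotangentSheaf X)).app V (trivSection c (twistCotangent E) x hV
      (0 : (dual E).over V ⟶ (cotangentSheaf X).over V)) = (0 : (dual (twist c E)).over V ⟶ (cotangentSheaf X).over V)
    rw [show trivSection c (twistCotangent E) x hV (0 : (dual E).over V ⟶ (cotangentSheaf X).over V) = 0 from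
      trivSection_zero c (twistCotangent E) x hV, map_zero]
    rfl

/-- **`J_x` is `𝒪_X`-linear for the twisted structures** (`λ((e ⊗ da) ⊗ t_x) = (e ⊗ t_x) ⊗ da`).
[cite: Atiyah1957, §4 (the module structure of D(E))] -/
theorem jetTwistFun_smul {V : X.left.Opens} (hV : V ≤ c.U x) (a : Γ(X.left, V)) (p : JetSections E V) :
    jetTwistFun c E x hV (a • p) = a • jetTwistFun c E x hV p := by
  refine JetSections.ext ?_ ?_
  · simp only [jetTwistFun_fst, JetSections.fst_smul, trivSection_smul]
  · rw [jetTwistFun_snd, JetSections.snd_smul, JetSections.snd_smul, jetTwistFun_snd, jetTwistFun_fst,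
      trivSection_add_hom, map_add, trivSection_smul_hom, Scheme.Modules.Hom.app_smul, deltaHom_eq_tensorForm,
      dualHomTwist_app_trivSection_tensorForm]
    rfl

/-- `J_x` commutes with restriction. [folklore] -/
theorem jetTwistFun_restrict {V V' : X.left.Opens} (hV : V ≤ c.U x) (i : V' ⟶ V) (p : JetSections E V) :
    jetTwistFun c E x (i.le.trans hV) (JetSections.restrict i p) = JetSections.restrict i (jetTwistFun c E x hV p) := by
  refine JetSections.ext ?_ ?_
  · simp only [jetTwistFun_fst, JetSections.fst_restrict, trivSection_map]
  · rw [jetTwistFun_snd, JetSections.snd_restrict, JetSections.snd_restrict, jetTwistFun_snd]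
    change _ = (twistCotangent (twist c E)).presheaf.map i.op
      ((dualHomTwist c E (cotangentSheaf X)).app V (trivSection c (twistCotangent E) x hV p.snd))
    rw [app_map_apply, trivSection_map]
    rfl

/-- **`J_x : P¹(E)|_W ⟶ P¹(E⟨c⟩)|_W`** over `W ⊆ U_x`: `(e, η) ↦ (e ⊗ t_x, λ(η ⊗ t_x))` — the jet module of `E`
transported along the local trivialisation `t_x : E| ≅ E⟨c⟩|`, with `λ : (E ⊗ Ω¹)⟨c⟩ → E⟨c⟩ ⊗ Ω¹` on the
form part. [cite: Atiyah1957, §4] -/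
def jetTwistOver : (jetModule E).over W ⟶ (jetModule (twist c E)).over W where
  val := PresheafOfModules.homMk
    { app := fun V => AddCommGrpCat.ofHom
        { toFun := fun p : JetSections E V.unop.left =>
            (jetTwistFun c E x (V.unop.hom.le.trans hW) p : JetSections (twist c E) V.unop.left)
          map_zero' := jetTwistFun_zero c E x _
          map_add' := fun p q => jetTwistFun_add c E x _ p q }
      naturality := fun {V V'} i => by
        ext p
        change jetTwistFun c E x (V'.unop.hom.le.trans hW) (JetSections.restrict i.unop.left p) =
          JetSections.restrict i.unop.left (jetTwistFun c E x (V.unop.hom.le.trans hW) p)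
        exact jetTwistFun_restrict c E x (V.unop.hom.le.trans hW) i.unop.left p }
    (fun V (a : Γ(X.left, V.unop.left)) (p : JetSections E V.unop.left) => by
      change jetTwistFun c E x _ (a • p) = a • jetTwistFun c E x _ p
      exact jetTwistFun_smul c E x _ a p)

/-- Values of `J_x`. [folklore] -/
@[simp]
theorem appLE_jetTwistOver {V : X.left.Opens} (k : V ⟶ W) (p : JetSections E V) :
    appLE (jetTwistOver c E x W hW) k (p : Γ(jetModule E, V)) =
      (jetTwistFun c E x (k.le.trans hW) p : Γ(jetModule (twist c E), V)) := rfl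

end Jet

end CocycleTwist

end Summit.Ventures.HSemireg

end
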